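import Summits.CriticalPhenomena.Ising3DConformalLimit.Theorems.PrecisionLaplacianDirectCorrelationStableTailPickInversionAux6

/-!
# Pick inversion, auxiliary file 7: Fourier coefficients of a cosine series and of the
# Nevanlinna integral on the circle

Helper file for stub `stub_pickInversion` of line `self-energy-pick-inversion`, crux
`PrecisionLaplacian.DirectCorrelationStableTail` (stmt-CriticalPhenomena-4799). Pure theorem file.

* `integral_mul_cos_of_hasSum_cos` : if `f(θ) = ∑ cₘ cos(mθ)` with `∑ |cₘ| < ∞` then
  `∫_{-π}^{π} f(θ) cos(nθ) dθ = π cₙ` for `n ≥ 1` (termwise integration);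
* `ae_cos_ne_one` : `cos θ ≠ 1` for a.e. `θ ∈ (-π, π]`;
* `integral_nevanlinna_integral_mul_cos` (registered sub-goal `stub_pickInversion_auxChebFubini`):
  for a σ-finite measure `ρ` with `ρ`-a.e. `s > 1` and `∫ dρ/(s(s-1)) < ∞`, the function
  `θ ↦ (∫ (1/(s - cos θ) - s/(1 + s²)) dρ(s)) cos(nθ)` is integrable on `[-π, π]` and its integral is
  `∫ 2π λ(s)ⁿ/√(s² - 1) dρ(s)`, `λ(s) = s - √(s² - 1)` (Fubini, then the Chebyshev coefficients of
  file 1; the kernel is dominated by `4π/(s(s - 1))`).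
-/

noncomputable section

namespace Summit.CriticalPhenomena.Ising3DConformalLimit.Cruxes.DirectCorrelationStableTail.SelfEnergyPickInversion

open MeasureTheory Filter Topology Set Real
open scoped BigOperators ENNReal NNReal
open Literature.Analysis.Complex

/-! ### Coefficients of an absolutely convergent cosine series -/

/-- **Termwise integration of a cosine series**: if `∑ |cₘ| < ∞` and `f(θ) = ∑ₘ cₘ cos(mθ)` for
all `θ`, then `∫_{-π}^{π} f(θ) cos(nθ) dθ = π cₙ` for every `n ≥ 1`. [folklore] -/
theorem integral_mul_cos_of_hasSum_cos {f : ℝ → ℝ} {c : ℕ → ℝ} (hc : Summable c)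
    (hf : ∀ θ, HasSum (fun m : ℕ => c m * Real.cos (m * θ)) (f θ)) {n : ℕ} (hn : 1 ≤ n) :
    ∫ θ in (-π)..π, f θ * Real.cos (n * θ) = π * c n := by
  have habs : Summable fun m => |c m| := hc.abs
  have hterm : HasSum (fun m : ℕ => ∫ θ in (-π)..π, c m * Real.cos (m * θ) * Real.cos (n * θ))
      (∫ θ in (-π)..π, f θ * Real.cos (n * θ)) := by
    refine intervalIntegral.hasSum_integral_of_dominated_convergence (fun m _ => |c m|)
      (fun m => (Continuous.aestronglyMeasurable (by fun_prop))) ?_ ?_ ?_ ?_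
    · intro m
      filter_upwards with θ _
      rw [Real.norm_eq_abs, abs_mul, abs_mul]
      have h1 := Real.abs_cos_le_one (m * θ)
      have h2 := Real.abs_cos_le_one (n * θ)
      calc |c m| * |Real.cos (m * θ)| * |Real.cos (n * θ)| ≤ |c m| * 1 * 1 := by
            gcongr
        _ = |c m| := by ring
    · exact Eventually.of_forall fun θ _ => habs
    · exact intervalIntegrable_const
    · filter_upwards with θ _
      exact (hf θ).mul_right _
  have hval : ∀ m : ℕ, ∫ θ in (-π)..π, c m * Real.cos (m * θ) * Real.cos (n * θ) =
      if m = n then π * c n else 0 := by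
    intro m
    have : (fun θ => c m * Real.cos (m * θ) * Real.cos (n * θ)) =
        fun θ => c m * (Real.cos (m * θ) * Real.cos (n * θ)) := by funext θ; ring
    rw [this, intervalIntegral.integral_const_mul]
    rcases Nat.eq_zero_or_pos m with hm | hm
    · subst hm
      simp only [Nat.cast_zero, zero_mul, Real.cos_zero, one_mul]
      rw [integral_cos_nat_mul, if_neg (by omega), if_neg (by omega), mul_zero]
    · rw [integral_cos_mul_cos hm hn]
      by_cases hmn : m = n
      · subst hmn; simp; ring
      · rw [if_neg hmn, if_neg hmn, mul_zero]
  simp_rw [hval] at hterm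
  exact hterm.unique (hasSum_ite_eq n (π * c n))

/-! ### `cos θ ≠ 1` almost everywhere on `(-π, π]` -/

/-- For a.e. `θ`, if `θ ∈ (-π, π]` then `cos θ ≠ 1` (the exceptional set is `{0}`). [folklore] -/
theorem ae_cos_ne_one : ∀ᵐ θ : ℝ, θ ∈ Set.uIoc (-π) π → Real.cos θ ≠ 1 := by
  have hπ := Real.pi_pos
  have h0 : (volume : Measure ℝ) {0} = 0 := measure_singleton 0
  rw [ae_iff]
  refine measure_mono_null (fun θ hθ => ?_) h0
  simp only [Set.mem_setOf_eq, Classical.not_imp, not_not] at hθ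
  obtain ⟨hmem, hcos⟩ := hθ
  rw [Set.uIoc_of_le (by linarith)] at hmem
  rw [Set.mem_singleton_iff]
  exact (Real.cos_eq_one_iff_of_lt_of_lt (by linarith [hmem.1]) (by linarith [hmem.2])).1 hcos

/-! ### The Nevanlinna integral on the circle: Fubini and the Chebyshev coefficients -/

/-- Pointwise bound for the real Nevanlinna kernel at `x = cos θ`, `s > 1`:
`|1/(s - cos θ) - s/(1 + s²)| ≤ (1 + s)/((1 + s²)(s - cos θ))`. [folklore] -/
theorem abs_real_nevanlinna_kernel_cos_le {s : ℝ} (hs : 1 < s) (θ : ℝ) :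
    |(s - Real.cos θ)⁻¹ - s / (1 + s ^ 2)| ≤ (1 + s) / ((1 + s ^ 2) * (s - Real.cos θ)) := by
  have hsc : 0 < s - Real.cos θ := by linarith [Real.cos_le_one θ]
  have heq : (s - Real.cos θ)⁻¹ - s / (1 + s ^ 2) = (1 + s * Real.cos θ) / ((1 + s ^ 2) * (s - Real.cos θ)) := by
    field_simp; ring
  have hden : 0 < (1 + s ^ 2) * (s - Real.cos θ) := mul_pos (by positivity) hsc
  rw [heq, abs_div, abs_of_pos hden]
  refine div_le_div_of_nonneg_right ?_ hden.le
  calc |1 + s * Real.cos θ| ≤ |(1 : ℝ)| + |s * Real.cos θ| := abs_add_le _ _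
    _ ≤ 1 + s := by
        rw [abs_one, abs_mul, abs_of_pos (by linarith)]
        have := Real.abs_cos_le_one θ
        nlinarith

/-- **The Nevanlinna integral on the circle.** Let `ρ` be σ-finite with `ρ`-a.e. `s > 1` and
`∫ dρ/(s(s - 1)) < ∞`, and `n ≥ 1`. Then `θ ↦ (∫ (1/(s - cos θ) - s/(1 + s²)) dρ(s)) cos(nθ)` is
integrable on `[-π, π]` and
`∫_{-π}^{π} (∫ (1/(s - cos θ) - s/(1 + s²)) dρ(s)) cos(nθ) dθ = ∫ 2π λ(s)ⁿ/√(s² - 1) dρ(s)`,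
`λ(s) = s - √(s² - 1)` (Fubini; the Chebyshev coefficients `integral_cos_div_sub_cos`). [folklore] -/
theorem integral_nevanlinna_integral_mul_cos {ρ : Measure ℝ} [SigmaFinite ρ]
    (hae : ∀ᵐ s ∂ρ, 1 < s) (hu : Integrable (fun s : ℝ => (s * (s - 1))⁻¹) ρ) {n : ℕ} (hn : 1 ≤ n) :
    IntervalIntegrable (fun θ : ℝ => (∫ s, ((s - Real.cos θ)⁻¹ - s / (1 + s ^ 2)) ∂ρ) * Real.cos (n * θ))
        volume (-π) π ∧
      ∫ θ in (-π)..π, (∫ s, ((s - Real.cos θ)⁻¹ - s / (1 + s ^ 2)) ∂ρ) * Real.cos (n * θ) =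
        ∫ s, 2 * π * (s - Real.sqrt (s ^ 2 - 1)) ^ n / Real.sqrt (s ^ 2 - 1) ∂ρ := by
  have hπ := Real.pi_pos
  set μθ : Measure ℝ := volume.restrict (Set.Ioc (-π) π) with hμθ
  haveI : IsFiniteMeasure μθ := ⟨by
    rw [hμθ, Measure.restrict_apply_univ, Real.volume_Ioc]; exact ENNReal.ofReal_lt_top⟩
  -- the kernel on the product
  set K : ℝ × ℝ → ℝ := fun p => ((p.2 - Real.cos p.1)⁻¹ - p.2 / (1 + p.2 ^ 2)) * Real.cos (n * p.1)
    with hK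
  have hKm : AEStronglyMeasurable K (μθ.prod ρ) := Measurable.aestronglyMeasurable (by fun_prop)
  -- for `s > 1`, `θ ↦ K (θ, s)` is continuous
  have hKcont : ∀ s : ℝ, 1 < s → Continuous fun θ : ℝ => K (θ, s) := by
    intro s hs
    simp only [hK]
    refine Continuous.mul (Continuous.sub (Continuous.inv₀ (by fun_prop) fun θ => ?_) continuous_const)
      (by fun_prop)
    linarith [Real.cos_le_one θ]
  -- inner integrals: the value and the norm bound
  have hinner : ∀ s : ℝ, 1 < s → ∫ θ, K (θ, s) ∂μθ = 2 * π * (s - Real.sqrt (s ^ 2 - 1)) ^ n / Real.sqrt (s ^ 2 - 1) := by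
    intro s hs
    rw [hμθ, ← intervalIntegral.integral_of_le (by linarith)]
    simp only [hK]
    have h1 : ∀ θ : ℝ, ((s - Real.cos θ)⁻¹ - s / (1 + s ^ 2)) * Real.cos (n * θ) =
        Real.cos (n * θ) / (s - Real.cos θ) - (s / (1 + s ^ 2)) * Real.cos (n * θ) := by
      intro θ; ring
    simp_rw [h1]
    rw [intervalIntegral.integral_sub, intervalIntegral.integral_const_mul, integral_cos_div_sub_cos hs n,
      integral_cos_nat_mul, if_neg (by omega), mul_zero, sub_zero]
    · refine Continuous.intervalIntegrable (Continuous.div (by fun_prop) (by fun_prop) fun θ => ?_) _ _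
      linarith [Real.cos_le_one θ]
    · exact Continuous.intervalIntegrable (by fun_prop) _ _
  have hnorm : ∀ s : ℝ, 1 < s → ∫ θ, ‖K (θ, s)‖ ∂μθ ≤ 4 * π * (s * (s - 1))⁻¹ := by
    intro s hs
    obtain ⟨hsq, -, hw, -⟩ := cheb_weight_bounds hs
    have hsqrt : 0 < Real.sqrt (s ^ 2 - 1) := Real.sqrt_pos.mpr (by nlinarith)
    have hbd : ∀ θ, ‖K (θ, s)‖ ≤ (1 + s) / (1 + s ^ 2) * (1 / (s - Real.cos θ)) := by
      intro θ
      simp only [hK, Real.norm_eq_abs, abs_mul]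
      have h1 := abs_real_nevanlinna_kernel_cos_le hs θ
      have h2 := Real.abs_cos_le_one (n * θ)
      have hsc : 0 < s - Real.cos θ := by linarith [Real.cos_le_one θ]
      calc |(s - Real.cos θ)⁻¹ - s / (1 + s ^ 2)| * |Real.cos (n * θ)|
          ≤ (1 + s) / ((1 + s ^ 2) * (s - Real.cos θ)) * 1 :=
            mul_le_mul h1 h2 (abs_nonneg _) (by positivity)
        _ = (1 + s) / (1 + s ^ 2) * (1 / (s - Real.cos θ)) := by
            rw [mul_one, div_mul_div_comm, mul_one]
    have hci : Continuous fun θ : ℝ => (1 + s) / (1 + s ^ 2) * (1 / (s - Real.cos θ)) := by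
      refine continuous_const.mul (Continuous.div continuous_const (by fun_prop) fun θ => ?_)
      linarith [Real.cos_le_one θ]
    calc ∫ θ, ‖K (θ, s)‖ ∂μθ ≤ ∫ θ, (1 + s) / (1 + s ^ 2) * (1 / (s - Real.cos θ)) ∂μθ := by
          refine integral_mono_of_nonneg (Eventually.of_forall fun θ => norm_nonneg _) ?_
            (Eventually.of_forall hbd)
          exact hci.continuousOn.integrableOn_compact isCompact_Icc |>.mono_set Set.Ioc_subset_Icc_self
      _ = (1 + s) / (1 + s ^ 2) * (2 * π / Real.sqrt (s ^ 2 - 1)) := by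
          rw [hμθ, ← intervalIntegral.integral_of_le (by linarith), intervalIntegral.integral_const_mul,
            integral_inv_sub_cos hs]
      _ = 2 * π * ((1 + s) / ((1 + s ^ 2) * Real.sqrt (s ^ 2 - 1))) := by
          field_simp
      _ ≤ 2 * π * (2 / (s * (s - 1))) := by gcongr
      _ = 4 * π * (s * (s - 1))⁻¹ := by ring
  -- integrability on the product
  have hKint : Integrable K (μθ.prod ρ) := by
    rw [integrable_prod_iff' hKm]
    constructor
    · filter_upwards [hae] with s hs
      exact (hKcont s hs).continuousOn.integrableOn_compact isCompact_Icc |>.mono_set Set.Ioc_subset_Icc_self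
    · refine Integrable.mono' (hu.const_mul (4 * π)) hKm.prod_swap.norm.integral_prod_right' ?_
      filter_upwards [hae] with s hs
      rw [Real.norm_eq_abs, abs_of_nonneg (integral_nonneg fun θ => norm_nonneg _)]
      exact hnorm s hs
  -- Fubini
  have hswap : ∫ θ, (∫ s, K (θ, s) ∂ρ) ∂μθ = ∫ s, (∫ θ, K (θ, s) ∂μθ) ∂ρ :=
    integral_integral_swap (f := fun θ s => K (θ, s)) hKint
  have hleft : ∀ θ, ∫ s, K (θ, s) ∂ρ = (∫ s, ((s - Real.cos θ)⁻¹ - s / (1 + s ^ 2)) ∂ρ) * Real.cos (n * θ) := by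
    intro θ; simp only [hK]; exact MeasureTheory.integral_mul_const _ _
  constructor
  · have h1 : Integrable (fun θ => ∫ s, K (θ, s) ∂ρ) μθ := hKint.integral_prod_left
    simp_rw [hleft] at h1
    rw [intervalIntegrable_iff_integrableOn_Ioc_of_le (by linarith)]
    exact h1
  · rw [intervalIntegral.integral_of_le (by linarith)]
    have h2 : ∫ θ in Set.Ioc (-π) π, (∫ s, ((s - Real.cos θ)⁻¹ - s / (1 + s ^ 2)) ∂ρ) * Real.cos (n * θ) =
        ∫ θ, (∫ s, K (θ, s) ∂ρ) ∂μθ := by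
      rw [hμθ]; exact integral_congr_ae (Eventually.of_forall fun θ => (hleft θ).symm)
    rw [h2, hswap]
    exact integral_congr_ae (hae.mono fun s hs => hinner s hs)

/-- **Registered auxiliary stub `stub_pickInversion_auxChebFubini`** (sub-goal of
`stub_pickInversion`): the cosine coefficients of the Nevanlinna integral on the circle
(`integral_nevanlinna_integral_mul_cos`). [folklore] -/
theorem stub_pickInversion_auxChebFubini : ∀ (ρ : MeasureTheory.Measure ℝ), MeasureTheory.SigmaFinite ρ →
    (∀ᵐ s ∂ρ, 1 < s) → MeasureTheory.Integrable (fun s : ℝ => (s * (s - 1))⁻¹) ρ → ∀ n : ℕ, 1 ≤ n →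
    ∫ θ in (-Real.pi)..Real.pi, (∫ s, ((s - Real.cos θ)⁻¹ - s / (1 + s ^ 2)) ∂ρ) * Real.cos (n * θ) =
      ∫ s, 2 * Real.pi * (s - Real.sqrt (s ^ 2 - 1)) ^ n / Real.sqrt (s ^ 2 - 1) ∂ρ :=
  fun _ hσ hae hu _ hn => by
    haveI := hσ
    exact (integral_nevanlinna_integral_mul_cos hae hu hn).2

end Summit.CriticalPhenomena.Ising3DConformalLimit.Cruxes.DirectCorrelationStableTail.SelfEnergyPickInversion

end
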